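import Summits.QuantumAdvantage.QuantumAdvantage.Theorems.PhaseDialE

/-! # PhaseDialF — part 6/6 of the landing twins of NODE «PhaseDial» (decomp-qadv lens-2 g25; node file
`g25/PhaseDial.lean`, sha256 bb3dee64cd7f1b2c…; generator `g25/tree/gen_twins.py`: namespace `Theses.PhaseDial` →
`Theorems.PhaseDial`, cut at section boundaries (node lines 1446–1718), nothing else).
Content: §8 the ODD PRIME-POWER cells REDUCE to the constant-degree characteristic-`p` ring rung `RingDegLoss p D` (`fgp`, `fgp_agree`, `fgp_primePow_mem`, `phase_primePow_of_ringDegLoss`, `phaseCell_primePow_of_ringDegLoss`, `phaseCell_212_of_ringDegLoss`; `ringDegLoss_of_ringHardOdd`, `ringDegLoss_two`, `primePow_cells_of_rungs`) and §9 the cells are ANTITONE under divisibility of the modulus (`mulEmb`, `stabPhase_dvd_mono`, `phaseCell_antitone`) with the exact frontier `phaseLoss3_iff_nonPrimePow_cells`. -/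

set_option linter.dupNamespace false
noncomputable section
open scoped Classical

namespace Summit.QuantumAdvantage.QuantumAdvantage.Theorems.PhaseDial
open Finset
open Literature.Computability.QuantumComplexity Literature.Computability.QuantumComplexity.RingHLF
open Literature.Computability.MetaComplexity Literature.Computability.MetaComplexity.Smolensky
open Summit.QuantumAdvantage.AdviceFreeQNC0
open Summit.QuantumAdvantage.QuantumAdvantage.Theorems.AnchorDial (outB dev loss_shape_mono)
open Summit.QuantumAdvantage.QuantumAdvantage.Theorems.StabilizerDial (apIdx apStrat apStrat_mem apStrat_apply pad
  pad_mem StabFew outB_pad_pad outB_pad_congr bitP_gsum gsum gsum_mem deg_gsum dev_congr eventually_polylog winset_pad)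
open Summit.QuantumAdvantage.QuantumAdvantage.Theorems.SparsityDial (real_loss_of_frac stabFew_mono_mr one_le_logpow)
open Summit.QuantumAdvantage.QuantumAdvantage.Theorems.ResponseDial (mem_dev_apStrat dev_pad_zero
  not_polylogSparse_of_agree)
open Summit.QuantumAdvantage.QuantumAdvantage.Theorems.CounterDial (CounterForm StabCounter)
open Summit.QuantumAdvantage.QuantumAdvantage.Theorems.AbelianDial (alin TableForm StabTable AbelianLoss3
  NonAbelianLoss3 tableForm_of_counterForm stabTable_of_stabCounter nT pcell qcell pcell_injective qcell_injective
  pcell_ne_qcell qG qG_apply qStrat qStrat_agree qStrat_mem6 mem_dev_q_second indB oddZeros_indB)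
open Summit.QuantumAdvantage.QuantumAdvantage.Theorems.AbelianDial (q_in_dense_class q_not_tableForm_zero
  q_not_counterForm_zero)
open Summit.QuantumAdvantage.QuantumAdvantage.Theorems.ShadowDial (aL aW aW_pos two_mul_le_two_pow aW_mul_eight aL_lt
  aL_add_three_le acell enc dcell acell_val dcell_val acell_injective dcell_injective acell_ne_dcell dcell_ne_zero
  dcell_lt_last muxStrat muxStrat_agree muxStrat_mem_logpow mem_dev_mux_second shadow shadow_pad_zero
  q_shadow_degree_linear)
open Summit.QuantumAdvantage.QuantumAdvantage.Theorems.ScaleDial (logpow_add_logpow_le)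

variable {N : ℕ}

/-! ## §8  THE ODD-PRIME-POWER CELLS REDUCE TO A CONSTANT-DEGREE RING RUNG IN CHARACTERISTIC `p`; the cell map, final

The Lucas engine of §7 is typed for EVERY prime.  For an odd prime power modulus `p^k` the value indicators of the `r`
phases are `𝔽_p`-polynomials of degree `≤ (p^k − 1)·d`, the table is a polynomial of degree `≤ r(p^k − 1)d`
(`table_mem_lowDeg'`), and — XOR of `{0,1}`-valued functions being `a + t − 2at` in odd characteristic — the output bit
`G_k(phases) ⊕ x_k ⊕ x_{k+1}` agrees on the odd class with a `{0,1}`-valued `𝔽_p`-polynomial of CONSTANT degree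
`≤ r(p^k − 1)d + 2` (`fgp`, `fgp_primePow_mem`, `fgp_agree`).  So the cell `(p^k − 1, r, d)` follows from the
characteristic-`p` ring law AT CONSTANT DEGREE with polynomial loss, `RingDegLoss p D` (`phaseCell_primePow_of_ringDegLoss`)
— a RUNG strictly below the polylog-degree constant-fraction crux `RingHardOdd p` (`ringDegLoss_of_ringHardOdd`; for
`p = 2` a theorem, `ringDegLoss_two`, recovering §7).  So ALL prime-power cells follow from the odd-characteristic
constant-degree rungs (`primePow_cells_of_rungs`); the cells whose modulus is NOT a prime power (two coprime moduli inside
one gate: the Constant-Degree-Hypothesis cells, `Literature.Barriers.QuantumAdvantage.TwoModuliDepthTwo`'s open side) are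
the special piece's exact frontier (§9).  The first prime-power cell beyond the decided ones, `(2, 1, 2)` ∋ `qStrat`,
needs exactly `RingDegLoss 3 6`: the mod-3 ring game against `{0,1}`-valued outputs of `𝔽₃`-degree `6`, polynomial loss —
above the tree's floor at this prime (`AffBells37.affBellsPolyLoss3`: AFFINE bells, whose docstring names «bells of
degree ≥ 2» as untouched) and below crux 22907 `RingHardOdd 3`. -/

section PrimePow
variable {r d : ℕ} {p : ℕ} [hp : Fact p.Prime]

/-- **`RingDegLoss p D` — the characteristic-`p` ring law AT CONSTANT DEGREE `D` with POLYNOMIAL loss**: strategies all of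
whose output polynomials have `𝔽_p`-degree `≤ D` win at most `(1 − n^{-C})·2^{n−1}` odd inputs, `n ≥ n₀`.  A rung below
`RingHardOdd p` (polylog degree, constant fraction): `ringDegLoss_of_ringHardOdd`; a theorem for `p = 2` (`ringDegLoss_two`). -/
def RingDegLoss (p : ℕ) [Fact p.Prime] (D : ℕ) : Prop :=
  ∃ C n₀ : ℕ, ∀ n ≥ n₀, ∀ P : Fin n → CubeFn (ZMod p) n, (∀ i, P i ∈ lowDeg (ZMod p) n D) →
    ((univ.filter fun x : Fin n → Bool => OddZeros x ∧ Rel x (fun i => decide (P i x = 1))).card : ℝ)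
      ≤ (1 - 1 / (n : ℝ) ^ C) * (2 : ℝ) ^ (n - 1)

omit hp in
/-- the polylog-degree constant-fraction law gives every constant-degree polynomial-loss rung (`C = 1`). -/
theorem ringDegLoss_of_ringHardOdd {q : ℕ} [Fact q.Prime] (h : RingHardOdd q) (D : ℕ) : RingDegLoss q D := by
  obtain ⟨θ, hθ, hall⟩ := h
  obtain ⟨M, hM⟩ := exists_nat_ge (1 / (1 - θ))
  obtain ⟨n₀, hn₀⟩ := hall 1
  refine ⟨1, max n₀ (max M (2 ^ D)), fun n hn P hP => ?_⟩
  have hn₀' : n₀ ≤ n := le_trans (le_max_left _ _) hn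
  have hM' : M ≤ n := le_trans (le_trans (le_max_left _ _) (le_max_right _ _)) hn
  have h2 : 2 ^ D ≤ n := le_trans (le_trans (le_max_right _ _) (le_max_right _ _)) hn
  have hn1 : 1 ≤ n := le_trans Nat.one_le_two_pow h2
  have hlog : D ≤ (Nat.log 2 n) ^ 1 := by
    rw [pow_one]; exact Nat.le_log_of_pow_le (by norm_num) h2
  have h := hn₀ n hn₀' P (fun i => lowDeg_mono hlog (hP i))
  have hθn : θ ≤ 1 - 1 / (n : ℝ) ^ 1 := by
    rw [pow_one]
    have h1θ : 0 < 1 - θ := by linarith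
    have hnpos : (0 : ℝ) < n := by exact_mod_cast (show 0 < n by omega)
    have hMr : 1 / (1 - θ) ≤ (n : ℝ) := le_trans hM (by exact_mod_cast hM')
    rw [div_le_iff₀ h1θ] at hMr
    have h3 : 1 / (n : ℝ) ≤ 1 - θ := by
      rw [div_le_iff₀ hnpos]; linarith
    linarith
  exact le_trans h (mul_le_mul_of_nonneg_right hθn (by positivity))

omit hp in
/-- the characteristic-2 rungs are theorems (the tree's `AdviceFreeQNC0.ringHardOdd_two`). -/
theorem ringDegLoss_two (D : ℕ) : RingDegLoss 2 D := ringDegLoss_of_ringHardOdd ringHardOdd_two D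

omit hp in
/-- XOR of bits as `{0,1}`-valued ring elements: `[b ⊕ c] = [b] + [c] − 2[b][c]`. -/
theorem ite_xor {F : Type*} [Field F] (b c : Bool) :
    (if xor b c then (1 : F) else 0) =
      (if b then (1 : F) else 0) + (if c then (1 : F) else 0) - 2 * ((if b then (1 : F) else 0) * (if c then (1 : F) else 0)) := by
  cases b <;> cases c <;> norm_num

omit hp in
/-- the canonical guess bit `x_i ⊕ x_{i+1}` as a `{0,1}`-valued function has degree `≤ 2` over every field. -/
theorem tGuess_ind_mem {F : Type*} [Field F] (i : Fin N) :
    (fun x : Fin N → Bool => if tGuess x i then (1 : F) else 0) ∈ lowDeg F N 2 := by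
  have e : (fun x : Fin N → Bool => if tGuess x i then (1 : F) else 0) =
      mono F {i} + mono F {nxt i} - (2 : F) • (mono F {i} * mono F {nxt i}) := by
    funext x
    simp only [Pi.add_apply, Pi.sub_apply, Pi.smul_apply, Pi.mul_apply, smul_eq_mul, mono_apply, mem_singleton,
      forall_eq]
    unfold tGuess
    exact ite_xor (x i) (x (nxt i))
  rw [e]
  have h1 : mono F ({i} : Finset (Fin N)) ∈ lowDeg F N 1 := mono_mem_lowDeg (by simp)
  have h2 : mono F ({nxt i} : Finset (Fin N)) ∈ lowDeg F N 1 := mono_mem_lowDeg (by simp)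
  have h12 : mono F ({i} : Finset (Fin N)) * mono F ({nxt i} : Finset (Fin N)) ∈ lowDeg F N (1 + 1) :=
    mul_mem_lowDeg_add h1 h2
  exact Submodule.sub_mem _
    (Submodule.add_mem _ (lowDeg_mono (show 1 ≤ 2 by norm_num) h1) (lowDeg_mono (show 1 ≤ 2 by norm_num) h2))
    (Submodule.smul_mem _ _ (lowDeg_mono (show 1 + 1 ≤ 2 by norm_num) h12))

omit hp in
/-- under phase form `(m, r, d)`: the would-be output bit `G_k(phases(x)) ⊕ t_k(x)` as a `{0,1}`-valued `F`-cube function … -/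
def fgp (F : Type*) [Field F] (m : ℕ) (w : Fin N → (Fin d → Fin N) → Fin r → ZMod (m + 1))
    (G : Fin N → (Fin r → ZMod (m + 1)) → Bool) (k : Fin N) : CubeFn F N :=
  fun x => if xor (G k (aphase m r d (w k) x)) (tGuess x k) then 1 else 0

omit hp in
/-- … AGREES with the true output bit on every odd input (any modulus, any field) … -/
theorem fgp_agree {F : Type*} [Field F] [DecidableEq F] {m : ℕ} {w : Fin N → (Fin d → Fin N) → Fin r → ZMod (m + 1)}
    {G : Fin N → (Fin r → ZMod (m + 1)) → Bool} {Q : Fin N → CubeFn (ZMod 3) N} (hF : PhaseForm m r d w G Q)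
    (x : Fin N → Bool) (hx : OddZeros x) (k : Fin N) : decide (fgp F m w G k x = 1) = decide (Q k x = 1) := by
  have h := hF x hx k
  simp only [Summit.QuantumAdvantage.QuantumAdvantage.Theorems.AnchorDial.dev, mem_filter, mem_univ, true_and] at h
  unfold fgp
  revert h
  generalize G k (aphase m r d (w k) x) = g
  generalize tGuess x k = t
  generalize decide (Q k x = 1) = q
  cases g <;> cases t <;> cases q <;> simp

/-- … and for the prime-power modulus `p^k` is an `𝔽_p`-polynomial of CONSTANT degree `≤ r·(p^k − 1)·d + 2`. -/
theorem fgp_primePow_mem (k : ℕ) (w : Fin N → (Fin d → Fin N) → Fin r → ZMod (p ^ k - 1 + 1))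
    (G : Fin N → (Fin r → ZMod (p ^ k - 1 + 1)) → Bool) (i : Fin N) :
    fgp (ZMod p) (p ^ k - 1) w G i ∈ lowDeg (ZMod p) N (r * ((p ^ k - 1) * d) + 2) := by
  have ha : (fun x => if G i (fun j => (fun y => aphase (p ^ k - 1) r d (w i) y j) x) then (1 : ZMod p) else 0)
      ∈ lowDeg (ZMod p) N (r * ((p ^ k - 1) * d)) :=
    table_mem_lowDeg' (G i) _ fun j v => phase_val_ind_mem (p := p) k (w i) j v
  have ht := tGuess_ind_mem (F := ZMod p) i
  have e : fgp (ZMod p) (p ^ k - 1) w G i =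
      (fun x => if G i (fun j => (fun y => aphase (p ^ k - 1) r d (w i) y j) x) then (1 : ZMod p) else 0) +
        (fun x : Fin N → Bool => if tGuess x i then (1 : ZMod p) else 0) -
        (2 : ZMod p) • ((fun x => if G i (fun j => (fun y => aphase (p ^ k - 1) r d (w i) y j) x) then (1 : ZMod p) else 0) *
          (fun x : Fin N → Bool => if tGuess x i then (1 : ZMod p) else 0)) := by
    funext x
    simp only [fgp, Pi.add_apply, Pi.sub_apply, Pi.smul_apply, Pi.mul_apply, smul_eq_mul]
    exact ite_xor _ _
  rw [e]
  exact Submodule.sub_mem _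
    (Submodule.add_mem _ (lowDeg_mono (Nat.le_add_right _ _) ha) (lowDeg_mono (by omega) ht))
    (Submodule.smul_mem _ _ (mul_mem_lowDeg_add ha ht))

/-- ★★ **REDUCTION OF THE PRIME-POWER CELLS**: the constant-degree rung `RingDegLoss p (r(p^k−1)d + 2)` gives the loss law
for cheaply `(p^k − 1, r, d)`-phase-form strategies — every prime `p`, every `k, r, d`, every gauge exponent, none of
the other hypotheses. -/
theorem phase_primePow_of_ringDegLoss (k r d : ℕ) (h : RingDegLoss p (r * ((p ^ k - 1) * d) + 2)) :
    ∃ C : ℕ, ∀ e : ℕ, ∃ n₀ : ℕ, ∀ n ≥ n₀, ∀ P : Fin n → CubeFn (ZMod 3) n,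
      StabPhase (p ^ k - 1) r d e P →
        ((univ.filter fun x : Fin n → Bool => OddZeros x ∧ Rel x (fun i => decide (P i x = 1))).card : ℝ)
          ≤ (1 - 1 / (n : ℝ) ^ C) * (2 : ℝ) ^ (n - 1) := by
  obtain ⟨C, n₀, hC⟩ := h
  refine ⟨C, fun e => ⟨n₀, fun n hn P hst => ?_⟩⟩
  obtain ⟨s, -, w, G, hF⟩ := hst
  have h := hC n hn (fun i => fgp (ZMod p) (p ^ k - 1) w G i) (fun i => fgp_primePow_mem k w G i)
  have hset : (univ.filter fun x : Fin n → Bool =>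
        OddZeros x ∧ Rel x (fun i => decide (fgp (ZMod p) (p ^ k - 1) w G i x = 1)))
      = univ.filter fun x : Fin n → Bool => OddZeros x ∧ Rel x (fun i => decide (P i x = 1)) := by
    rw [← winset_pad P s]
    refine Finset.filter_congr fun x _ => and_congr_right fun hx => ?_
    rw [show (fun i => decide (fgp (ZMod p) (p ^ k - 1) w G i x = 1)) = (fun i => decide (pad P s i x = 1)) from
      funext fun i => fgp_agree hF x hx i]
  rw [hset] at h
  exact h

/-- ★★ the cell at a prime-power modulus follows from the constant-degree rung in that characteristic. -/
theorem phaseCell_primePow_of_ringDegLoss (k r d : ℕ) (h : RingDegLoss p (r * ((p ^ k - 1) * d) + 2)) :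
    PhaseCell (p ^ k - 1) r d := by
  obtain ⟨C, hC⟩ := phase_primePow_of_ringDegLoss k r d h
  refine ⟨0, 0, 0, C, fun c => ?_⟩
  obtain ⟨n₀, h⟩ := hC (c + 1)
  exact ⟨n₀, fun n hn P _ _ _ _ hφ => h n hn P hφ⟩

/-- sanity edge (not a route — `RingHardOdd 3` is crux 22907): the polylog crux in characteristic `p` decides every
modulus-`p^k` cell. -/
theorem phaseCell_primePow_of_ringHardOdd (h : RingHardOdd p) (k r d : ℕ) : PhaseCell (p ^ k - 1) r d :=
  phaseCell_primePow_of_ringDegLoss k r d (ringDegLoss_of_ringHardOdd h _)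

/-- the first open cell `(2, 1, 2)` ∋ `qStrat` (one quadratic phase mod 3) needs exactly the degree-`6` rung at `p = 3`. -/
theorem phaseCell_212_of_ringDegLoss (h : RingDegLoss 3 6) : PhaseCell 2 1 2 := by
  have h' : RingDegLoss 3 (1 * ((3 ^ 1 - 1) * 2) + 2) := by simpa using h
  simpa using phaseCell_primePow_of_ringDegLoss (p := 3) 1 1 2 h'

omit hp in
/-- the prime-power SUB-RUNGS of the special piece all follow from the odd-characteristic constant-degree ring rungs
(the characteristic-2 ones being theorems). -/
theorem primePow_cells_of_rungs (hR : ∀ (q : ℕ) (hq : q.Prime), q ≠ 2 → ∀ D : ℕ, @RingDegLoss q ⟨hq⟩ D)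
    {q : ℕ} (hq : q.Prime) (k r d : ℕ) : PhaseCell (q ^ k - 1) r d := by
  by_cases hq2 : q = 2
  · subst hq2; exact phaseCell_twoPow k r d
  · exact @phaseCell_primePow_of_ringDegLoss q ⟨hq⟩ k r d (hR q hq hq2 _)

end PrimePow

/-! ## §9  THE CELLS ARE ANTITONE UNDER DIVISIBILITY OF THE MODULUS; THE SPECIAL PIECE IS EXACTLY ITS NON-PRIME-POWER CELLS

`Z_{m+1} ↪ Z_{t(m+1)}`, `a ↦ t·a`, carries a phase form of type `(m, r, d)` to one of type `(t(m+1) − 1, r, d)` (same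
phases, rescaled coefficients, table pulled back along `v ↦ v / t`): `stabPhase_dvd_mono`.  So a cell at a modulus
implies the cells at all its divisors (`phaseCell_antitone`), and since every modulus divides a non-prime-power one
(`6(m+1)`), the special piece is EQUIVALENT to the conjunction of its cells at moduli that are NOT prime powers, `d ≥ 2`
(`phaseLoss3_iff_nonPrimePow_cells`) — the genuinely-two-coprime-moduli (Constant-Degree-Hypothesis) cells are its exact
frontier; the prime-power cells (§7 decided for `2^k`, §8 reduced to `RingDegLoss p D` for odd `p`) are its weaker
single-characteristic SUB-RUNGS (`primePow_cells_of_rungs`). -/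

section Antitone
variable {r d m m' t : ℕ}

/-- the modulus embedding `Z_{m+1} → Z_{m'+1}`, `a ↦ t·a` on representatives (a homomorphism when `m'+1 = t(m+1)`). -/
def mulEmb (m m' t : ℕ) (a : ZMod (m + 1)) : ZMod (m' + 1) := ((t * a.val : ℕ) : ZMod (m' + 1))

/-- its left inverse on the image, `v ↦ v / t` on representatives. -/
def divBack (m m' t : ℕ) (v : ZMod (m' + 1)) : ZMod (m + 1) := ((v.val / t : ℕ) : ZMod (m + 1))

/-- `mulEmb` is additive when `m' + 1 = t·(m + 1)` (representatives rescale, the modulus rescales with them). -/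
theorem mulEmb_add (h : m' + 1 = t * (m + 1)) (a b : ZMod (m + 1)) :
    mulEmb m m' t (a + b) = mulEmb m m' t a + mulEmb m m' t b := by
  unfold mulEmb
  rw [← Nat.cast_add, ZMod.natCast_eq_natCast_iff', ZMod.val_add, h, ← mul_add, Nat.mul_mod_mul_left,
    Nat.mul_mod_mul_left, Nat.mod_mod]

/-- `mulEmb` as an additive homomorphism. -/
def mulHom (m m' t : ℕ) (h : m' + 1 = t * (m + 1)) : ZMod (m + 1) →+ ZMod (m' + 1) :=
  AddMonoidHom.mk' (mulEmb m m' t) (mulEmb_add h)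

/-- `divBack` is a left inverse of `mulEmb` when `m' + 1 = t·(m + 1)` (no wrap-around: `t·a.val < m' + 1`). -/
theorem divBack_mulEmb (h : m' + 1 = t * (m + 1)) (a : ZMod (m + 1)) : divBack m m' t (mulEmb m m' t a) = a := by
  have ht : 0 < t := Nat.pos_of_ne_zero (by rintro rfl; simp at h)
  unfold divBack mulEmb
  rw [ZMod.val_natCast, Nat.mod_eq_of_lt (by rw [h]; exact Nat.mul_lt_mul_of_pos_left (ZMod.val_lt a) ht),
    Nat.mul_div_cancel_left _ ht, ZMod.natCast_zmod_val]

/-- rescaling the coefficients rescales the phases. -/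
theorem aphase_mulEmb (h : m' + 1 = t * (m + 1)) (w : (Fin d → Fin N) → Fin r → ZMod (m + 1)) (x : Fin N → Bool)
    (j : Fin r) : aphase m' r d (fun τ j => mulEmb m m' t (w τ j)) x j = mulEmb m m' t (aphase m r d w x j) := by
  unfold aphase
  rw [show mulEmb m m' t (∑ τ : Fin d → Fin N, if (∀ s, x (τ s) = true) then w τ j else 0)
      = ∑ τ : Fin d → Fin N, mulEmb m m' t (if (∀ s, x (τ s) = true) then w τ j else 0) from
    map_sum (mulHom m m' t h) _ _]
  refine Finset.sum_congr rfl fun τ _ => ?_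
  split_ifs
  · rfl
  · simp [mulEmb]

/-- ★ phase form `(m, r, d)` ⟹ phase form `(m', r, d)` whenever `(m+1) ∣ (m'+1)`. -/
theorem phaseForm_mulEmb (h : m' + 1 = t * (m + 1)) {w : Fin N → (Fin d → Fin N) → Fin r → ZMod (m + 1)}
    {G : Fin N → (Fin r → ZMod (m + 1)) → Bool} {Q : Fin N → CubeFn (ZMod 3) N} (hF : PhaseForm m r d w G Q) :
    PhaseForm m' r d (fun k τ j => mulEmb m m' t (w k τ j)) (fun k u => G k (fun j => divBack m m' t (u j))) Q := by
  intro x hx k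
  have key : (fun j => divBack m m' t (aphase m' r d (fun τ j => mulEmb m m' t (w k τ j)) x j)) = aphase m r d (w k) x :=
    funext fun j => by rw [aphase_mulEmb h, divBack_mulEmb h]
  show k ∈ dev Q x ↔ G k (fun j => divBack m m' t (aphase m' r d (fun τ j => mulEmb m m' t (w k τ j)) x j)) = true
  rw [key]
  exact hF x hx k

/-- ★ cheap phase form is MONOTONE under divisibility of the modulus. -/
theorem stabPhase_dvd_mono (h : m' + 1 = t * (m + 1)) {e : ℕ} {P : Fin N → CubeFn (ZMod 3) N}
    (hP : StabPhase m r d e P) : StabPhase m' r d e P := by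
  obtain ⟨s, hs, w, G, hF⟩ := hP
  exact ⟨s, hs, _, _, phaseForm_mulEmb h hF⟩

/-- ★ the cells are ANTITONE: the cell at a modulus implies the cell at each of its divisors. -/
theorem phaseCell_antitone (h : m' + 1 = t * (m + 1)) (hc : PhaseCell m' r d) : PhaseCell m r d := by
  obtain ⟨M, R, a, C, hall⟩ := hc
  refine ⟨M, R, a, C, fun c => ?_⟩
  obtain ⟨n₀, hn⟩ := hall c
  exact ⟨n₀, fun n hn' P hP h1 h2 h3 h4 => hn n hn' P hP h1 h2 h3 (stabPhase_dvd_mono h h4)⟩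

/-- `6(m+1)` is not a prime power. -/
theorem not_isPrimePow_six_mul (m : ℕ) : ¬ IsPrimePow (6 * (m + 1)) := by
  rw [isPrimePow_iff_unique_prime_dvd]
  rintro ⟨q, -, hu⟩
  have h2 := hu 2 ⟨Nat.prime_two, Dvd.dvd.mul_right (by norm_num) _⟩
  have h3 := hu 3 ⟨Nat.prime_three, Dvd.dvd.mul_right (by norm_num) _⟩
  omega

/-- ★★★ **THE FRONTIER, EXACTLY**: the special piece is EQUIVALENT to the conjunction of its cells with `d ≥ 2` at moduli
`≥ 3` that are NOT PRIME POWERS — two coprime moduli inside one gate, the Constant-Degree-Hypothesis cells.  (Its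
prime-power cells are weaker sub-rungs: `primePow_cells_of_rungs`, §7, §8.) -/
theorem phaseLoss3_iff_nonPrimePow_cells :
    PhaseLoss3 ↔ ∀ m r d : ℕ, 2 ≤ d → ¬ IsPrimePow (m + 1) → 2 ≤ m → PhaseCell m r d := by
  refine ⟨fun h m r d _ _ _ => (phaseLoss3_iff.mp h) m r d, fun hM => ?_⟩
  rw [phaseLoss3_iff]
  intro m r d
  by_cases hd : d ≤ 1
  · exact phaseCell_decided m r d (Or.inl hd)
  by_cases hm : m ≤ 1
  · exact phaseCell_decided m r d (Or.inr hm)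
  have h6 : ¬ IsPrimePow (6 * (m + 1) - 1 + 1) := by
    rw [show 6 * (m + 1) - 1 + 1 = 6 * (m + 1) by omega]; exact not_isPrimePow_six_mul m
  exact phaseCell_antitone (m' := 6 * (m + 1) - 1) (t := 6) (by omega) (hM _ r d (by omega) h6 (by omega))

end Antitone

end Summit.QuantumAdvantage.QuantumAdvantage.Theorems.PhaseDial
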